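import Summits.BirchSwinnertonDyer.Rank1Residual.F1Sign2.BranchCongruenceModTwoAtTwoHolds
import Summits.BirchSwinnertonDyer.Rank1Residual.F1Sign2.MultiplicativeAtTwoRepaired
import Literature.NumberTheory.EllipticCurves.PAdicLFunctionPlusMultDistributionProofs
import Literature.NumberTheory.EllipticCurves.PAdicLFunctionMinusMultDistributionProofs
import Literature.NumberTheory.EllipticCurves.PAdicLFunctionIntegralityAtTwoSplitMultProofs
import Literature.NumberTheory.EllipticCurves.NewformPeterssonSizeSymmSquareProofs
import Literature.NumberTheory.EllipticCurves.PlusSymbolBoundOddMultiplicativeProofs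
import Literature.NumberTheory.EllipticCurves.LFunctionPrimeCoeffMultiplicative
import Literature.NumberTheory.EllipticCurves.PAdicMeasureTransform
import HarnessLib

/-!
# F1Sign2 / MultBranchEstimatesAtTwo — the `2`-adic estimates behind A♮L at a multiplicative `2`
(cell `bsd-f1-sign2`, seat `-imc` g1; PROOF-ONLY module, part 1 of 2 of the proof that the tree conjecture
`RhombicBranchCongruence` (p543248) holds; part 2 = `RhombicBranchCongruenceHolds.lean`. Over the tree
statements `BranchCongruenceModTwoAtTwo.lean` p543248 / `MultiplicativeAtTwoRepaired.lean` and the proofs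
`RhombicSymbolCongruenceHolds.lean` p544233 (A♮sym) / `BranchCongruenceModTwoAtTwoHolds.lean` (§B). No `def`
of mathematical content; no restatement.)

TURNKEY filing by the typer seat `bsd-f1-sign2-ty` (INBOX 2026-08-27T16:13/16:18Z, T-imc-4b-1 (F1Sign2ProofsC1.lean)): the
planner-of-record's kernel-checked file `HOME/MEMO-imc-data/F1Sign2ProofsC1.lean` sha16 4e4d8e268d06e07d (split shape farm-checked in
`F1Sign2ProofsC_split_check.lean`: rc 0, 0 warnings, 0 sorries, standard axioms), re-filed VERBATIM (bib key spelling
`CremonaAlgorithms1997`). PROOF-ONLY module: no definition, no named fact. PARTITION: none moved.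

Contents (§C, part 1): the valuation estimate `‖C(2ⁿ,k+1)‖₂·‖k+1‖₂ ≤ 2⁻ⁿ` and its consequence that
`c · C(2ⁿ, k+1)` is eventually `2`-integral for any fixed `c ∈ ℚ₂`; the `Δ = {±1}`-doubling of an EVEN
family (`finsum_weighted_two_of_even`); convergence of the one-term plus-branch Riemann sums from the
distribution relation (`tendsto_padicLPlusBranchMultRiemannSum_of`); evenness and the level-`m+2` unfolding
of the one-term measures; the KEY finite-level estimate `norm_multRiemannSum_sub_le_half` (under the symbol
congruence `PlusMinusSymbolCongruenceAtTwo f`, eventually `‖S⁺_n(ω⁰) − S⁻_n(ω¹)‖₂ ≤ 2⁻¹` coefficientwise),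
its limit form `norm_padicLMultCoeff_sub_le_half`, and the measure bound `norm_msdPlusMeasureMult_two_le`.
Method: A♮sym (`rhombicSymbolCongruence_holds`) gives per cell `μ⁺ − μ⁻ = a₂^{−(n+2)}([1/2]⁺ + k_b)`,
`k_b ∈ ℤ`; the offset sums (hockey stick) to `a₂^{−(n+2)}[1/2]⁺·C(2ⁿ, k+1)`, and — the one new estimate
versus §B, where the offset carried a factor `(α − 1)` — `‖C(2ⁿ,k+1)‖₂·‖k+1‖₂ ≤ 2⁻ⁿ`
(`(k+1)C(2ⁿ,k+1) = 2ⁿC(2ⁿ−1,k)`), so the offset is EVENTUALLY `2`-integral whatever the fixed rational value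
`[1/2]⁺_f`; no bound on `[1/2]⁺_f`, hence no `E[2]`/torsion hypothesis, is needed.
Sources: MSD measures and branches [cite: MazurTateTeitelbaum1986Invent, §I.10–§I.13]; lattice types and
cusp classes [cite: CremonaAlgorithms1997, §2.10; Lemma 2.2.3]. Axioms: propext, Classical.choice, Quot.sound
(combined farm check, -imc g1 folder `bc/proofsC_combined.lean`).
-/

set_option autoImplicit false

noncomputable section

open scoped Classical MatrixGroups ModularForm
open CongruenceSubgroup Polynomial
open Literature.NumberTheory.EllipticCurves Literature.NumberTheory.EllipticCurves.ModularForms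
open Literature.NumberTheory.EllipticCurves.Greenberg1999
open Literature.NumberTheory.EllipticCurves.Rank1Residual
open Summit.BirchSwinnertonDyer.Rank1Residual.X1.MuLambda
open Summit.BirchSwinnertonDyer.Rank1Residual.X5

namespace Summit.BirchSwinnertonDyer.Rank1Residual.F1Sign2

/-! ## §C. A♮L at a MULTIPLICATIVE `2` (`2 ∥ N`): the one-term branches are congruent mod `2Λ₂`

Same mechanism over the one-term measures `μ⁺_{f,a₂}(a + 2ᵐℤ₂) = a₂⁻ᵐ[a/2ᵐ]⁺`,
`μ⁻_{f,a₂}(a + 2ᵐℤ₂) = a₂⁻ᵐ[a/2ᵐ]⁻` (`a₂ = a₂(f) = ±1` for `2 ∥ N`,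
`IsNewform0.cuspCoeff_sq_eq_one_of_dvd_of_not_sq_dvd`): the `Δ = {±1}`-doubling (plus side:
`finsum_weighted_two_of_even`, evenness `ratPlusSymbol_neg_val_div`; minus side: the tree's
`finsum_weighted_two_of_odd`), A♮sym per cell `μ⁺ − μ⁻ = a₂^{−(n+2)}([1/2]⁺ + k_b)`, and the offset
`[1/2]⁺ · C(2ⁿ, k+1)`, which now carries NO factor `(α − 1)` but DECAYS: `‖C(2ⁿ,k+1)‖₂·‖k+1‖₂ ≤ 2⁻ⁿ`
(`(k+1)C(2ⁿ,k+1) = 2ⁿC(2ⁿ−1,k)`), so it is eventually `2`-integral whatever the (fixed, rational) value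
of `[1/2]⁺_f` — no bound on `[1/2]⁺_f = (a₂ − 1)[0]⁺_f` is needed, hence no `E[2]`/torsion hypothesis.
Integrality of `L⁺` is read off from that of `L⁻` (`exists_iwasawaToPowerSeries_eq_padicLFunctionMinusBranchMult_two`)
and `‖L⁺ − L⁻‖ ≤ 2⁻¹`. Consequence: the tree conjecture `RhombicBranchCongruence` (p543248, both clauses)
is a THEOREM (`rhombicBranchCongruence_holds`). -/

section MultBranchAlgebra

open Filter Topology

/-- `‖2‖₂ = 2⁻¹`. [folklore] -/
private theorem norm_two_two'' : ‖(2 : ℚ_[2])‖ = (2 : ℝ)⁻¹ := by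
  have h := Padic.norm_p (p := 2)
  simpa using h

/-- `‖m‖₂ ≤ 1` for a natural number `m`. [folklore] -/
private theorem norm_natCast_le_one'' (m : ℕ) : ‖((m : ℕ) : ℚ_[2])‖ ≤ 1 := by
  have h := Padic.norm_int_le_one (p := 2) (m : ℤ)
  rwa [Int.cast_natCast] at h

/-- `‖C(2ⁿ, k+1)‖₂ · ‖k+1‖₂ ≤ 2⁻ⁿ`, from `(k+1)·C(2ⁿ,k+1) = 2ⁿ·C(2ⁿ−1,k)`. [folklore] -/
theorem norm_choose_two_pow_succ_mul_le (n k : ℕ) :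
    ‖(((2 ^ n).choose (k + 1) : ℕ) : ℚ_[2])‖ * ‖((k + 1 : ℕ) : ℚ_[2])‖ ≤ 2⁻¹ ^ n := by
  have h2 : 2 ^ n - 1 + 1 = 2 ^ n := Nat.sub_add_cancel Nat.one_le_two_pow
  have h : (2 ^ n).choose (k + 1) * (k + 1) = 2 ^ n * (2 ^ n - 1).choose k := by
    have := Nat.add_one_mul_choose_eq (2 ^ n - 1) k
    rw [h2] at this
    exact this.symm
  have hc : (((2 ^ n).choose (k + 1) : ℕ) : ℚ_[2]) * ((k + 1 : ℕ) : ℚ_[2]) =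
      (2 : ℚ_[2]) ^ n * (((2 ^ n - 1).choose k : ℕ) : ℚ_[2]) := by
    have hc' := congrArg (fun m : ℕ ↦ (m : ℚ_[2])) h
    simpa only [Nat.cast_mul, Nat.cast_pow, Nat.cast_ofNat] using hc'
  rw [← norm_mul, hc, norm_mul, norm_pow, norm_two_two'']
  exact mul_le_of_le_one_right (pow_nonneg (by norm_num) n) (norm_natCast_le_one'' _)

/-- For fixed `c ∈ ℚ₂` and `k`: `‖c · C(2ⁿ, k+1)‖₂ ≤ 1` for all large `n`. [folklore] -/
theorem eventually_norm_mul_choose_two_pow_le_one (c : ℚ_[2]) (k : ℕ) :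
    ∀ᶠ n in atTop, ‖c * (((2 ^ n).choose (k + 1) : ℕ) : ℚ_[2])‖ ≤ 1 := by
  have hk : 0 < ‖((k + 1 : ℕ) : ℚ_[2])‖ :=
    norm_pos_iff.mpr (Nat.cast_ne_zero.mpr (Nat.succ_ne_zero k))
  have ht : Tendsto (fun n : ℕ ↦ ‖c‖ * (2⁻¹ : ℝ) ^ n) atTop (𝓝 (‖c‖ * 0)) :=
    (tendsto_pow_atTop_nhds_zero_of_lt_one (by norm_num) (by norm_num)).const_mul ‖c‖
  rw [mul_zero] at ht
  filter_upwards [ht.eventually (gt_mem_nhds hk)] with n hn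
  rw [norm_mul]
  have h1 := norm_choose_two_pow_succ_mul_le n k
  have h2 : ‖c‖ * ‖(((2 ^ n).choose (k + 1) : ℕ) : ℚ_[2])‖ * ‖((k + 1 : ℕ) : ℚ_[2])‖ ≤
      ‖c‖ * 2⁻¹ ^ n := by
    rw [mul_assoc]; exact mul_le_mul_of_nonneg_left h1 (norm_nonneg _)
  have h3 : ‖c‖ * ‖(((2 ^ n).choose (k + 1) : ℕ) : ℚ_[2])‖ * ‖((k + 1 : ℕ) : ℚ_[2])‖ <
      1 * ‖((k + 1 : ℕ) : ℚ_[2])‖ := by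
    rw [one_mul]; exact h2.trans_lt hn
  exact (lt_of_mul_lt_mul_right h3 hk.le).le

/-- The `2`-adic roots of unity of order dividing `2` are `±1`. [folklore] -/
private theorem coe_rootsOfUnity_two_eq_one_or_neg_one (ξ : rootsOfUnity 2 ℤ_[2]) :
    ((ξ : ℤ_[2]ˣ) : ℤ_[2]) = 1 ∨ ((ξ : ℤ_[2]ˣ) : ℤ_[2]) = -1 := by
  have h := ξ.2
  rw [mem_rootsOfUnity] at h
  have h' : (((ξ : ℤ_[2]ˣ) : ℤ_[2])) ^ 2 = 1 := by
    rw [← Units.val_pow_eq_pow_val, h, Units.val_one]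
  exact sq_eq_one_iff.mp h'

/-- **The `Δ = {±1}`-doubling for an EVEN family at `p = 2`**: if `μ(−a + 2ᵐℤ₂) = μ(a + 2ᵐℤ₂)` and `i`
is even, `∑_ζ ζ^i ∑_{s mod 2ⁿ} μ(ζ5ˢ + 2ⁿ⁺²ℤ₂) C(s,k) = 2 · ∑_s μ(5ˢ + 2ⁿ⁺²ℤ₂) C(s,k)`. Even twin of
the tree's `finsum_weighted_two_of_odd`. [cite: MazurTateTeitelbaum1986Invent, §I.13 (p = 2: Δ = {±1}, γ = 5)] -/
theorem finsum_weighted_two_of_even {μ : (n : ℕ) → ZMod (2 ^ n) → ℚ_[2]}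
    (heven : ∀ (n : ℕ) (a : ZMod (2 ^ n)), μ n (-a) = μ n a) {i : ℕ} (hi : Even i) (k n : ℕ) :
    ∑ᶠ ζ : rootsOfUnity (torsionOrder 2) ℤ_[2], ∑ s : ZMod (2 ^ n),
        ((((ζ : ℤ_[2]ˣ) : ℤ_[2]) : ℚ_[2]) ^ i *
          μ (n + cyclotomicExponent 2)
            (PadicInt.toZModPow (n + cyclotomicExponent 2) ((ζ : ℤ_[2]ˣ) : ℤ_[2]) *
              (cyclotomicGenerator 2 : ZMod (2 ^ (n + cyclotomicExponent 2))) ^ s.val) *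
          ((s.val.choose k : ℕ) : ℚ_[2])) =
      2 * ∑ s : ZMod (2 ^ n), μ (n + 2) ((cyclotomicGenerator 2 : ZMod (2 ^ (n + 2))) ^ s.val) *
        ((s.val.choose k : ℕ) : ℚ_[2]) := by
  classical
  set G : ℤ_[2] → ℚ_[2] := fun u ↦ ∑ s : ZMod (2 ^ n),
    ((u : ℚ_[2])) ^ i * μ (n + 2) (PadicInt.toZModPow (n + 2) u *
        (cyclotomicGenerator 2 : ZMod (2 ^ (n + 2))) ^ s.val) * ((s.val.choose k : ℕ) : ℚ_[2])
    with hG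
  have hG1 : G 1 = ∑ s : ZMod (2 ^ n),
      μ (n + 2) ((cyclotomicGenerator 2 : ZMod (2 ^ (n + 2))) ^ s.val) *
        ((s.val.choose k : ℕ) : ℚ_[2]) := by
    simp only [hG, map_one, one_mul, PadicInt.coe_one, one_pow]
  have hGneg : G (-1) = G 1 := by
    rw [hG1]
    simp only [hG, map_neg, map_one, neg_one_mul, heven, PadicInt.coe_neg, PadicInt.coe_one,
      hi.neg_one_pow, one_mul]
  have hζmem : (-1 : ℤ_[2]ˣ) ∈ rootsOfUnity 2 ℤ_[2] := by
    rw [mem_rootsOfUnity]; norm_num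
  set ζ : rootsOfUnity 2 ℤ_[2] := ⟨-1, hζmem⟩ with hζ
  have hne : (1 : rootsOfUnity 2 ℤ_[2]) ≠ ζ := by
    intro h
    have h' : (((1 : rootsOfUnity 2 ℤ_[2]) : ℤ_[2]ˣ) : ℤ_[2]) = ((ζ : ℤ_[2]ˣ) : ℤ_[2]) := by
      rw [h]
    rw [hζ] at h'
    simp only [OneMemClass.coe_one, Units.val_one, Units.val_neg] at h'
    have h2 : (2 : ℤ_[2]) = 0 := by linear_combination h'
    exact two_ne_zero h2
  haveI : Fintype (rootsOfUnity 2 ℤ_[2]) := Fintype.ofFinite _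
  have huniv : (Finset.univ : Finset (rootsOfUnity 2 ℤ_[2])) = {1, ζ} := by
    ext ξ
    simp only [Finset.mem_univ, Finset.mem_insert, Finset.mem_singleton, true_iff]
    rcases coe_rootsOfUnity_two_eq_one_or_neg_one ξ with h | h
    · left
      exact Subtype.ext (Units.ext (by simpa using h))
    · right
      exact Subtype.ext (Units.ext (by rw [hζ]; simpa using h))
  have hL : (∑ᶠ ξ : rootsOfUnity (torsionOrder 2) ℤ_[2], ∑ s : ZMod (2 ^ n),
        ((((ξ : ℤ_[2]ˣ) : ℤ_[2]) : ℚ_[2]) ^ i *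
          μ (n + cyclotomicExponent 2)
            (PadicInt.toZModPow (n + cyclotomicExponent 2) ((ξ : ℤ_[2]ˣ) : ℤ_[2]) *
              (cyclotomicGenerator 2 : ZMod (2 ^ (n + cyclotomicExponent 2))) ^ s.val) *
          ((s.val.choose k : ℕ) : ℚ_[2]))) =
      ∑ᶠ ξ : rootsOfUnity (torsionOrder 2) ℤ_[2], G ((ξ : ℤ_[2]ˣ) : ℤ_[2]) := rfl
  rw [hL, torsionOrder_two, finsum_eq_sum_of_fintype, huniv, Finset.sum_pair hne]
  simp only [OneMemClass.coe_one, Units.val_one, hζ, Units.val_neg]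
  rw [hGneg, hG1, two_mul]

/-- **Riemann sums of the one-term plus `ω^i`-branch converge** (granted the distribution relation and a
bound): plus twin of the tree's `tendsto_padicLMinusBranchMultRiemannSum`, same generic proof.
[cite: MazurTateTeitelbaum1986Invent, §I.13] -/
theorem tendsto_padicLPlusBranchMultRiemannSum_of {p : ℕ} [Fact p.Prime] {N : ℕ}
    (f : CuspForm (Gamma0 N) 2) (α : ℚ_[p])
    (hdist : ∀ (n : ℕ) (a : ZMod (p ^ n)),
      ∑ b ∈ Finset.univ.filter (fun b : ZMod (p ^ (n + 1)) ↦
        ZMod.castHom (pow_dvd_pow p n.le_succ) (ZMod (p ^ n)) b = a),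
          msdPlusMeasureMult f α (n + 1) b = msdPlusMeasureMult f α n a)
    {C : ℝ} (hC : ∀ (n : ℕ) (a : ZMod (p ^ n)), ‖msdPlusMeasureMult f α n a‖ ≤ C) (i k : ℕ) :
    Tendsto (padicLPlusBranchMultRiemannSum f α i k) atTop
      (𝓝 (padicLPlusBranchMultCoeff f α i k)) :=
  tendsto_riemannSum_of_distribution (μ := branchTwist i (msdPlusMeasureMult f α))
    (RS := padicLPlusBranchMultRiemannSum f α i)
    (fun k n ↦ weightedRiemannSum_eq (RS := padicLPlusBranchMultRiemannSum f α i) (fun _ _ ↦ rfl)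
      hdist k n)
    (branchTwist_distribution hdist i) (norm_branchTwist_le hC i) k

variable {N : ℕ} [NeZero N]

/-- The one-term plus measure is EVEN at `2`: `μ⁺(−a + 2ᵐℤ₂) = μ⁺(a + 2ᵐℤ₂)` (`ratPlusSymbol_neg_val_div`).
[cite: MazurTateTeitelbaum1986Invent, §I.8 ([−r]⁺ = [r]⁺)] -/
theorem msdPlusMeasureMult_neg_two (f : CuspForm (Gamma0 N) 2) (α : ℚ_[2]) :
    ∀ (m : ℕ) (a : ZMod (2 ^ m)), msdPlusMeasureMult f α m (-a) = msdPlusMeasureMult f α m a := by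
  intro m a
  unfold msdPlusMeasureMult
  rw [ratPlusSymbol_neg_val_div]

omit [NeZero N] in
/-- The one-term measures at level `m + 2` over `p = 2`, unfolded. -/
theorem msdPlusMeasureMult_two_level (f : CuspForm (Gamma0 N) 2) (α : ℚ_[2]) (m : ℕ)
    (a : ZMod (2 ^ (m + 2))) :
    msdPlusMeasureMult f α (m + 2) a =
      α⁻¹ ^ (m + 2) * ((ratPlusSymbol f ((a.val : ℚ) / (2 : ℚ) ^ (m + 2)) : ℚ) : ℚ_[2]) := by
  simp [msdPlusMeasureMult]

omit [NeZero N] in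
/-- The one-term minus measure at level `m + 2` over `p = 2`, unfolded. -/
theorem msdMinusMeasureMult_two_level (f : CuspForm (Gamma0 N) 2) (α : ℚ_[2]) (m : ℕ)
    (a : ZMod (2 ^ (m + 2))) :
    msdMinusMeasureMult f α (m + 2) a =
      α⁻¹ ^ (m + 2) * ((ratMinusSymbol f ((a.val : ℚ) / (2 : ℚ) ^ (m + 2)) : ℚ) : ℚ_[2]) := by
  simp [msdMinusMeasureMult]

/-- **KEY FINITE-LEVEL ESTIMATE, multiplicative.** Under the symbol congruence and `‖α⁻¹‖ ≤ 1`, at every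
level `n` where the offset `[1/2]⁺·C(2ⁿ,k+1)` is `2`-integral:
`‖RS⁺_{ω⁰}(k,n) − RS⁻_{ω¹}(k,n)‖₂ ≤ 2⁻¹` for the one-term branches. -/
theorem norm_multRiemannSum_sub_le_half (f : CuspForm (Gamma0 N) 2) {α : ℚ_[2]} (hα : ‖α⁻¹‖ ≤ 1)
    (hPM : PlusMinusSymbolCongruenceAtTwo f) {k n : ℕ}
    (hoff : ‖((ratPlusSymbol f (1 / 2) : ℚ) : ℚ_[2]) * (((2 ^ n).choose (k + 1) : ℕ) : ℚ_[2])‖ ≤ 1) :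
    ‖padicLPlusBranchMultRiemannSum f α 0 k n - padicLMinusBranchMultRiemannSum f α 1 k n‖ ≤ 2⁻¹ := by
  classical
  unfold padicLPlusBranchMultRiemannSum padicLMinusBranchMultRiemannSum
  rw [finsum_weighted_two_of_even (μ := msdPlusMeasureMult f α) (msdPlusMeasureMult_neg_two f α)
      (⟨0, rfl⟩ : Even 0) k n,
    finsum_weighted_two_of_odd (μ := msdMinusMeasureMult f α) (msdMinusMeasureMult_neg f α) odd_one k n]
  set c : ℚ_[2] := ((ratPlusSymbol f (1 / 2) : ℚ) : ℚ_[2]) with hcdef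
  have hαi : ∀ j : ℕ, ‖α⁻¹ ^ j‖ ≤ 1 := fun j ↦ by
    rw [norm_pow]; exact pow_le_one₀ (norm_nonneg _) hα
  -- per-cell identity from the symbol congruence
  have hμ : ∀ s : ZMod (2 ^ n), ∃ k₁ : ℤ,
      msdPlusMeasureMult f α (n + 2) ((cyclotomicGenerator 2 : ZMod (2 ^ (n + 2))) ^ s.val) -
        msdMinusMeasureMult f α (n + 2) ((cyclotomicGenerator 2 : ZMod (2 ^ (n + 2))) ^ s.val) =
      α⁻¹ ^ (n + 2) * (c + k₁) := by
    intro s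
    set b : ZMod (2 ^ (n + 2)) := (cyclotomicGenerator 2 : ZMod (2 ^ (n + 2))) ^ s.val with hb
    have hbo : Odd ((b.val : ℕ) : ℤ) := (odd_val_cyclotomicGenerator_pow n s.val).natCast
    obtain ⟨k₁, hk₁⟩ := hPM (b.val : ℤ) (n + 2) hbo (by omega)
    push_cast at hk₁
    have hk₁' := congrArg (fun q : ℚ ↦ (q : ℚ_[2])) hk₁
    push_cast at hk₁'
    refine ⟨k₁, ?_⟩
    rw [msdPlusMeasureMult_two_level f α n b, msdMinusMeasureMult_two_level f α n b, hcdef]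
    linear_combination α⁻¹ ^ (n + 2) * hk₁'
  choose k₁ hk using hμ
  -- regroup the difference of the two sums
  have hsum : ∑ s : ZMod (2 ^ n),
      msdPlusMeasureMult f α (n + 2) ((cyclotomicGenerator 2 : ZMod (2 ^ (n + 2))) ^ s.val) *
          ((s.val.choose k : ℕ) : ℚ_[2]) -
        ∑ s : ZMod (2 ^ n),
          msdMinusMeasureMult f α (n + 2) ((cyclotomicGenerator 2 : ZMod (2 ^ (n + 2))) ^ s.val) *
            ((s.val.choose k : ℕ) : ℚ_[2]) =
      ∑ s : ZMod (2 ^ n), α⁻¹ ^ (n + 2) * (k₁ s : ℚ_[2]) * ((s.val.choose k : ℕ) : ℚ_[2]) +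
        α⁻¹ ^ (n + 2) * c * ∑ s : ZMod (2 ^ n), ((s.val.choose k : ℕ) : ℚ_[2]) := by
    rw [← Finset.sum_sub_distrib, Finset.mul_sum, ← Finset.sum_add_distrib]
    refine Finset.sum_congr rfl fun s _ ↦ ?_
    rw [← sub_mul, hk s]
    ring
  rw [← mul_sub, hsum, norm_mul, norm_two_two'']
  -- hockey stick
  have hS : ∑ s : ZMod (2 ^ n), ((s.val.choose k : ℕ) : ℚ_[2]) =
      (((2 ^ n).choose (k + 1) : ℕ) : ℚ_[2]) := by
    rw [sum_zmod_val_eq_sum_range (2 ^ n) (fun j ↦ ((j.choose k : ℕ) : ℚ_[2])), ← Nat.cast_sum,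
      sum_range_choose_eq_choose_succ]
  -- the integral part
  have hA : ‖∑ s : ZMod (2 ^ n), α⁻¹ ^ (n + 2) * (k₁ s : ℚ_[2]) * ((s.val.choose k : ℕ) : ℚ_[2])‖ ≤ 1 := by
    refine IsUltrametricDist.norm_sum_le_of_forall_le_of_nonneg zero_le_one fun s _ ↦ ?_
    rw [norm_mul, norm_mul]
    calc _ ≤ 1 * 1 * 1 :=
          mul_le_mul (mul_le_mul (hαi _) (Padic.norm_int_le_one _) (norm_nonneg _) zero_le_one)
            (norm_natCast_le_one'' _) (norm_nonneg _) (by norm_num)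
      _ = 1 := by norm_num
  -- the offset part (eventually integral by `hoff`)
  have hB : ‖α⁻¹ ^ (n + 2) * c * ∑ s : ZMod (2 ^ n), ((s.val.choose k : ℕ) : ℚ_[2])‖ ≤ 1 := by
    rw [hS, mul_assoc, norm_mul]
    calc _ ≤ 1 * 1 := mul_le_mul (hαi _) hoff (norm_nonneg _) zero_le_one
      _ = 1 := mul_one _
  have hAB := (IsUltrametricDist.norm_add_le_max _ _).trans (max_le hA hB)
  calc (2 : ℝ)⁻¹ * _ ≤ 2⁻¹ * 1 := by gcongr
    _ = 2⁻¹ := mul_one _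

/-- **`‖[Tᵏ](L₂⁺(f,α,ω⁰) − L₂⁻(f,α,ω¹))‖₂ ≤ 2⁻¹` for every `k`** (one-term branches), granted the two
distribution relations and bounds and the symbol congruence. -/
theorem norm_padicLMultCoeff_sub_le_half (f : CuspForm (Gamma0 N) 2) {α : ℚ_[2]} (hα : ‖α⁻¹‖ ≤ 1)
    (hPM : PlusMinusSymbolCongruenceAtTwo f)
    (hdistp : ∀ (n : ℕ) (a : ZMod (2 ^ n)),
      ∑ b ∈ Finset.univ.filter (fun b : ZMod (2 ^ (n + 1)) ↦
        ZMod.castHom (pow_dvd_pow 2 n.le_succ) (ZMod (2 ^ n)) b = a),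
          msdPlusMeasureMult f α (n + 1) b = msdPlusMeasureMult f α n a)
    (hdistm : ∀ (n : ℕ) (a : ZMod (2 ^ n)),
      ∑ b ∈ Finset.univ.filter (fun b : ZMod (2 ^ (n + 1)) ↦
        ZMod.castHom (pow_dvd_pow 2 n.le_succ) (ZMod (2 ^ n)) b = a),
          msdMinusMeasureMult f α (n + 1) b = msdMinusMeasureMult f α n a)
    {Cp : ℝ} (hbp : ∀ (m : ℕ) (a : ZMod (2 ^ m)), ‖msdPlusMeasureMult f α m a‖ ≤ Cp)
    {Cm : ℝ} (hbm : ∀ (m : ℕ) (a : ZMod (2 ^ m)), ‖msdMinusMeasureMult f α m a‖ ≤ Cm) (k : ℕ) :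
    ‖padicLPlusBranchMultCoeff f α 0 k - padicLMinusBranchMultCoeff f α 1 k‖ ≤ 2⁻¹ := by
  have hT := (tendsto_padicLPlusBranchMultRiemannSum_of f α hdistp hbp 0 k).sub
    (tendsto_padicLMinusBranchMultRiemannSum f α hdistm hbm 1 k)
  exact le_of_tendsto hT.norm
    ((eventually_norm_mul_choose_two_pow_le_one _ k).mono fun n hn ↦
      norm_multRiemannSum_sub_le_half f hα hPM hn)

/-- **`‖μ⁺_{f,α}(a + 2ᵐℤ₂)‖₂ ≤ max(‖[0]⁺‖₂, ‖[1/2]⁺‖₂, 2)`** for the one-term plus measure, `2 ∣ N`,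
`4 ∤ N`, `‖α⁻¹‖ ≤ 1`: the cusp `a/2ᵐ` is `0` (value `[0]⁺`) or `Γ₀(N)`-equivalent to `1/2`
(`exists_ratPlusSymbol_sub_half_eq_div_two`: `[a/2ᵐ]⁺ = [1/2]⁺ + z/2`).
[cite: MazurTateTeitelbaum1986Invent, §I.8, §I.10] [cite: CremonaAlgorithms1997, §2.2 Lemma 2.2.3] -/
theorem norm_msdPlusMeasureMult_two_le (f : CuspForm (Gamma0 N) 2)
    (hrat : ∀ r : ℚ, (ratPlusSymbol f r : ℝ) = normalizedPlusSymbol f r)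
    (hreal : ∀ n, (cuspCoeff f n).im = 0) (h2N : 2 ∣ N) (h4 : ¬ 4 ∣ N) {α : ℚ_[2]}
    (hα : ‖α⁻¹‖ ≤ 1) (m : ℕ) (a : ZMod (2 ^ m)) :
    ‖msdPlusMeasureMult f α m a‖ ≤
      max ‖((ratPlusSymbol f 0 : ℚ) : ℚ_[2])‖ (max ‖((ratPlusSymbol f (1 / 2) : ℚ) : ℚ_[2])‖ 2) := by
  set r : ℚ := ((a.val : ℕ) : ℚ) / ((2 : ℕ) : ℚ) ^ m with hr
  have hval : msdPlusMeasureMult f α m a = α⁻¹ ^ m * ((ratPlusSymbol f r : ℚ) : ℚ_[2]) := rfl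
  have h1 : ‖α⁻¹ ^ m‖ ≤ 1 := by rw [norm_pow]; exact pow_le_one₀ (norm_nonneg _) hα
  have hsym : ‖((ratPlusSymbol f r : ℚ) : ℚ_[2])‖ ≤
      max ‖((ratPlusSymbol f 0 : ℚ) : ℚ_[2])‖ (max ‖((ratPlusSymbol f (1 / 2) : ℚ) : ℚ_[2])‖ 2) := by
    by_cases hden : r.den = 1
    · have hrn : r = ((r.num : ℤ) : ℚ) := ((Rat.den_eq_one_iff r).mp hden).symm
      have h0 : ratPlusSymbol f r = ratPlusSymbol f 0 := by
        rw [hrn, ← zero_add ((r.num : ℤ) : ℚ), ratPlusSymbol_add_intCast_eq]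
      rw [h0]
      exact le_max_left _ _
    · have hdvd : r.den ∣ 2 ^ m := by
        rw [hr]
        have h := Rat.den_dvd (a.val : ℤ) ((2 : ℤ) ^ m)
        rw [Rat.divInt_eq_div] at h
        push_cast at h
        exact_mod_cast h
      obtain ⟨z, hz⟩ := exists_ratPlusSymbol_sub_half_eq_div_two f hrat hreal h2N h4 hdvd hden
      have e : ratPlusSymbol f r = ratPlusSymbol f (1 / 2) + (z : ℚ) / 2 := by linear_combination hz
      rw [e]
      push_cast
      refine le_max_of_le_right ((IsUltrametricDist.norm_add_le_max _ _).trans (max_le_max le_rfl ?_))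
      rw [norm_div, norm_two_two'', div_le_iff₀ (by norm_num)]
      calc ‖(z : ℚ_[2])‖ ≤ 1 := Padic.norm_int_le_one _
        _ = 2 * 2⁻¹ := by norm_num
  rw [hval, norm_mul]
  calc ‖α⁻¹ ^ m‖ * _ ≤ 1 * _ := mul_le_mul h1 hsym (norm_nonneg _) zero_le_one
    _ = _ := one_mul _

end MultBranchAlgebra

end Summit.BirchSwinnertonDyer.Rank1Residual.F1Sign2
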